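import Mathlib
import HarnessLib
import Literature.Analysis.FluidPDE.Tao2016AveragedNS.RenormalisedCascadeWaves
import Literature.Analysis.FluidPDE.Tao2016AveragedNS.SelfSimilarCascadeBlowup
import Summits.NavierStokesRegularity.NavierStokesRegularity.Theses.TaoLadderRungTwoBreak
import Summits.NavierStokesRegularity.NavierStokesRegularity.Theorems.TaoLadderRungTwoBreakNoSurvivingDSSOneStubEmbedSurviving

/-!
# Crux `TaoLadderRungTwoBreak.NoSurvivingDSSOne` (stmt-NavierStokesRegularity-20205): the registered skeleton's
# COMPOSITION in the tree, closed modulo exactly the one open stub `stub_eternalLiouville`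

The registered skeleton `NoSurvivingDSSOne_birth.lean` (sha16 `73b53d2f2a6a7842`, planner theory-1 g6) composes
`stub_embedSurviving` (LANDED: `…NoSurvivingDSSOneStubEmbedSurviving`, p814221) and `stub_eternalLiouville`
(K1^∞_fwd(·,1) = `∀ R ≥ 1, NoSurvivingEternalFwd R 1`, the hard transfer stub) into the crux.  Here that
composition is re-typed against the route declaration with the open stub quoted VERBATIM as a hypothesis:
`noSurvivingDSSOne_of_stub_eternalLiouville` — a non-trivial surviving admissible DSS wave would embed
(`stub_embedSurviving`) as a forward-surviving admissible eternal solution, which the stub forbids.  After this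
file ⟨20205⟩ is, in the tree, EXACTLY its one open stub along this line (and that stub also serves ⟨20419⟩'s
(ρ0), `…NoSurvivingEternalViscBddOneLinks.stub_noSurvivingEternalBddOne_of_stub_eternalLiouville`).

HONEST LABEL: bookkeeping; MODEL lattice of Tao 2016 §4 only; ⟨20205⟩, `stub_eternalLiouville` and every NS
statement remain OPEN; nothing here bears on the summit.
-/

noncomputable section

-- the summit and its single sub-problem share the name (CONVENTIONS §1)
set_option linter.dupNamespace false

namespace Summit.NavierStokesRegularity.NavierStokesRegularity.Theorems.NoSurvivingDSSOne.Birth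

open Literature.Analysis.FluidPDE Literature.Analysis.FluidPDE.TaoCascade
open Summit.NavierStokesRegularity.NavierStokesRegularity.Theses.TaoLadderRungTwoBreak

/-- **The skeleton's composition, closed modulo `stub_eternalLiouville`.**  The registered stub
`stub_eternalLiouville` (signature VERBATIM as the hypothesis) gives the crux `NoSurvivingDSSOne` BY NAME: a
profile `Φ r x ≠ 0` of a surviving admissible DSS wave embeds as a forward-surviving admissible eternal solution
(landed `stub_embedSurviving`), contradicting the stub at the same threshold.
[cite: Tao2016AveragedNS, §4 Thm. 4.2 (statement shape), (4.1)–(4.4), §6.4; cell composition (theory-1 `NoSurvivingDSSOne_of`)] -/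
theorem noSurvivingDSSOne_of_stub_eternalLiouville
    (h : ∀ R : ℝ, 1 ≤ R → ∃ εs : ℝ, 0 < εs ∧ ∀ ε₀ : ℝ, 0 < ε₀ → ε₀ ≤ εs →
      ∀ α : (Fin 4 → Fin 4 → Fin 4 → ℤ × ℤ × ℤ → ℝ), InTableClass R α →
        ∀ W : ℤ → ℝ → Em 4, IsEternal ε₀ α W → ¬ EternalSurvivingFwd 1 ε₀ W) :
    NoSurvivingDSSOne := by
  intro R hR
  obtain ⟨εs, hεs, H⟩ := h R hR
  refine ⟨εs, hεs, fun ε₀ hε₀ hle α hα q π T Φ hW hS r x => ?_⟩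
  by_contra hne
  obtain ⟨hE, hF⟩ := stub_embedSurviving ε₀ α q π T Φ r x hε₀ hW hS hne
  exact H ε₀ hε₀ hle α hα _ hE hF

/-- The same composition through the tree's lemma-layer name: `stub_eternalLiouville` is `∀ R ≥ 1,
NoSurvivingEternalFwd R 1`, and `NoSurvivingDSSOne` is `∀ R ≥ 1, NoSurvivingDSS R 1`
(`noSurvivingDSS_of_noSurvivingEternalFwd`, K1^∞_fwd ⇒ K1).
[cite: Tao2016AveragedNS, §4 Thm. 4.2 (statement shape); cell vocabulary] -/
theorem noSurvivingDSSOne_of_noSurvivingEternalFwdOne (h : ∀ R : ℝ, 1 ≤ R → NoSurvivingEternalFwd R 1) :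
    NoSurvivingDSSOne :=
  fun R hR => noSurvivingDSS_of_noSurvivingEternalFwd (h R hR)

end Summit.NavierStokesRegularity.NavierStokesRegularity.Theorems.NoSurvivingDSSOne.Birth

end
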